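import Literature.GroupTheory.SpecificGroups.PGL2DicksonCharP
import HarnessLib

/-!
# Finite subgroups of `PGL₂(k)` in characteristic `p`, VIII: the cases `p = 2` and `q = 3`
(Faber's §6.1.1 for `q = 3`, §6.1.2, §6.1.3) at the level of orders, and Dickson's theorem for
`p`-irregular subgroups in all characteristics

Topic `GroupTheory/SpecificGroups`; theorems only, no definitions, no named facts.  Eighth part
of the series `PGL2SylowCharP` (I) … `PGL2DicksonCharP` (VI), `PGL2SubfieldImageCharP` (VII)
formalising X. Faber, *Finite `p`-irregular subgroups of `PGL₂(k)`*, arXiv:1112.1999 =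
La Matematica 2 (2023) [Faber2011] after L. E. Dickson, *Linear groups* (1901), Ch. XII
[Dickson1901].  Part VI assembled Faber's Theorem B over `k = k̄` for `p ≥ 5` only; this part
supplies what is needed of the remaining cases — in normal form (`IsNormalised`, part IV:
a Sylow `p`-subgroup `P ≠ 1` of order `q` fixes `∞` and is not normal, `Γ(H) = 𝔽_q`,
`d = |Λ(H)|`) — at the level of ORDERS, which is what the descent to `SL₂(𝔽_Q)`
(`SL2LargeSubgroupsFixLine`) consumes:

* `IsNormalised.card_le_of_smul_infty_mem` — `|H| ≤ q d |S|` whenever the orbit `H·∞ ⊆ S`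
  (`|Stab_H(∞)| = q d`, orbit–stabiliser; Faber's Lemma 6.4).
* **`p = 2`, `q > 2` (§6.1.2)**: `exists_smul_infty_eq_coe_of_sq_eq_one` (an involution `s ∈ H`
  has `s.∞ = α/γ = μ_η/(η+1) ∈ 𝔽_q`, from the trace condition `γμ + α(η+1) = 0` in
  characteristic `2`), `exists_smul_infty_eq_coe_of_two` (**the orbit of `∞` is `⊆ ℙ¹(𝔽_q)`**),
  **`card_eq_of_two`: `|H| = q(q² - 1)`** (so `f = 1`; the identification `H = PSL₂(𝔽_q)` itself
  is not needed downstream and not proved here).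
* **`q = 3`, `d = 1` (§6.1.1, `q = 3`)**: `exists_lift_det_eq_one_of_card_Gamma_eq_three` (every
  element of `H` has a determinant-`1` lift with lower-left entry in `𝔽_3` — Faber: "every
  element of `G` may be represented by a matrix with determinant `1` and lower left entry in
  `𝔽_3`"), **`card_le_twelve_of_card_Gamma_eq_three`: `|H| ≤ 12`** (the orbit of `∞` lies in
  `{∞} ∪ (x₀ + 𝔽_3)`: for rational-lower-left lifts `g, g'` of `h, h'`, the lower-left entry
  `γα' + δγ'` of `gg'` is rational up to sign).  (`H = PSL₂(𝔽_3) ≅ 𝔄₄` is not proved here.)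
* **`p = 2`, `q = 2` (§6.1.3)**: **`exists_index_two_of_card_Gamma_eq_two`** — `H` has a subgroup
  of index `2` of odd order (`|H| = 2·(1 + 2f)` and `τ_1` acts on `H` by an odd permutation; Faber
  shows `H ≅ 𝔇_{1+2f}`, not needed here).
* **`exists_smul_eq_or_of_dvd_card` — Dickson's theorem for finite `p`-irregular `H ≤ PGL₂(k̄)`,
  all `p`, order level**: `H` fixes a point, or is conjugate to `PSL₂(𝔽_q)`/`PGL₂(𝔽_q)`, or
  (`p = 2`) `|H| = q(q²-1)` with `q > 3`, or `|H| ≤ 60` (`p = 3`: `𝔄₅`, `PSL₂(𝔽_3)`), or (`p = 2 = q`)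
  `H` has an odd-order subgroup of index `2`.

## What is NOT here

The identifications `H = PSL₂(𝔽_q)` for `p = 2` (§6.1.2: the entries `β_i` are also rational),
`H = PSL₂(𝔽_3)` for `q = 3`, `H ≅ 𝔄₅` (§6.2.2, Lemma 4.20) and `H` dihedral (§6.1.3), i.e. the
conjugacy statements of Faber's Theorem 6.1 in these cases; the descent Theorems C–D.

## References

* [Faber2011] X. Faber, *Finite p-irregular subgroups of PGL₂(k)*, arXiv:1112.1999 (2011); La
  Matematica 2 (2023) 479–522 — Thm. 6.1, Lemma 6.3, Lemma 6.4, §6.1.1 (case `q = 3`), §6.1.2,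
  §6.1.3 (read 2026-08-22, `lit read arxiv:1112.1999`, pp. 16–18).
* [Dickson1901] L. E. Dickson, *Linear groups with an exposition of the Galois field theory*,
  Teubner (1901), Ch. XII, §260.
-/

open scoped MatrixGroups OnePoint Pointwise
open Matrix MulAction

namespace Literature.GroupTheory.SpecificGroups.PGL2

open Literature.NumberTheory.GaloisRepresentations

variable {k : Type*} [Field k]

variable [DecidableEq k] (p : ℕ) [Fact p.Prime] [CharP k p]
variable {H : Subgroup PGL(Fin 2, k)} [Finite H]

namespace IsNormalised

variable {p} (hN : IsNormalised p H)
include hN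

/-! ### The order from the orbit of `∞` -/

/-- **`|H| = q · d · |H·∞|`** in normal form: `|Stab_H(∞)| = q d` and the index of the
stabiliser is the size of the orbit of `∞`; hence if the orbit lies in a finite set `S`,
`|H| ≤ q d |S|` (Faber 2011, Lemma 6.3 (2): "`|G| = |Λ| (1 + fq) q`", with Lemma 6.4: the
cosets of `N` correspond to the points `s_i.∞`). [cite: Faber2011, Lemma 6.3, Lemma 6.4] -/
theorem card_le_of_smul_infty_mem [IsAlgClosed k] {S : Finset (OnePoint k)}
    (hS : ∀ h ∈ H, h • (∞ : OnePoint k) ∈ S) :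
    Nat.card H ≤ Nat.card (Gamma H) * Nat.card (Lambda H) * S.card := by
  classical
  obtain ⟨P, hP1, hPi⟩ := hN.exists_sylow
  have hStab := card_stabilizer_eq_card_translSubgroup_mul H
  rw [← sylow_eq_translSubgroup p H P hPi, ← card_Gamma_eq_card_sylow p H P hPi] at hStab
  have hmul := Subgroup.card_mul_index (stabilizer H (∞ : OnePoint k))
  have hidx : (stabilizer H (∞ : OnePoint k)).index ≤ S.card := by
    rw [MulAction.index_stabilizer, ← Set.ncard_coe_finset]
    refine Set.ncard_le_ncard ?_ (Finset.finite_toSet S)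
    intro x hx
    obtain ⟨h, rfl⟩ := MulAction.mem_orbit_iff.mp hx
    rw [Subgroup.smul_def]
    exact hS _ h.2
  rw [← hmul, hStab]
  exact Nat.mul_le_mul_left _ hidx

/-! ### Characteristic `2`, `q > 2`: the orbit of `∞` is `ℙ¹(𝔽_q)` (Faber §6.1.2) -/

/-- In characteristic `2` the number of multipliers is `d = q - 1` (every unit of `𝔽_q` is a
multiplier). [cite: Faber2011, Lemma 6.3] -/
theorem card_Lambda_eq_of_two [IsAlgClosed k] (hp : p = 2) :
    Nat.card (Lambda H) = Nat.card (Gamma H) - 1 := by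
  rcases hN.card_Lambda_eq_or with h | ⟨h2, -⟩
  · exact h
  · exact absurd hp h2

/-- **An involution of `H` moves `∞` into `𝔽_q`** (`p = 2`, `q > 2`, normal form; Faber 2011,
§6.1.2: "`α_i = μ_{i,η}/(η² - 1) ∈ 𝔽_q`", here as `s.∞ = α/γ = μ_η/(η + 1)`): for `s ∈ H` with
`s² = 1` not fixing `∞`, `s • ∞ ∈ 𝔽_q`. [cite: Faber2011, §6.1.2] -/
theorem exists_smul_infty_eq_coe_of_sq_eq_one [IsAlgClosed k] (hp : p = 2)
    (hq : Nat.card (Gamma H) ≠ 2) {s : H} (hs : (s : PGL(Fin 2, k)) • (∞ : OnePoint k) ≠ ∞)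
    (hs2 : (s : PGL(Fin 2, k)) ^ 2 = 1) :
    ∃ c ∈ stabField (Gamma H), (s : PGL(Fin 2, k)) • (∞ : OnePoint k) = (c : OnePoint k) := by
  classical
  subst hp
  haveI := hN.finite_stabField
  haveI : Fintype (stabField (Gamma H)) := Fintype.ofFinite _
  set F := stabField (Gamma H) with hF
  -- a unipotent lift `g`: `tr g = 0`, `det g = 1`, `γ ≠ 0`
  obtain ⟨g, hgs, hg2⟩ := KleinGeometry.exists_lift_pow_eq_one (s : PGL(Fin 2, k)) two_pos hs2
  obtain ⟨htr, hdet⟩ := trace_eq_two_and_det_eq_one_of_pow_char_eq_one 2 hg2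
  have hγ : g 1 0 ≠ 0 := by
    intro h0; apply hs; rw [← hgs, mk_smul_infty_eq_self_iff]; exact h0
  have h11 : g 1 1 = g 0 0 := by
    have h2 : (2 : k) = 0 := CharTwo.two_eq_zero
    rw [Matrix.trace_fin_two, h2] at htr
    have : g 1 1 = -g 0 0 := by
      have h' : (g : Matrix (Fin 2) (Fin 2) k) 0 0 + (g : Matrix (Fin 2) (Fin 2) k) 1 1 = 0 := htr
      linear_combination h'
    rw [this, CharTwo.neg_eq]
  -- an `η ∈ 𝔽_q ∖ {0, 1}` (`q ≥ 3`)
  obtain ⟨η, hηF, hη0, hη1⟩ : ∃ η ∈ F, η ≠ 0 ∧ η ≠ 1 := by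
    have hcard : ({0, 1} : Finset F).card < (Finset.univ : Finset F).card := by
      rw [Finset.card_univ, ← Nat.card_eq_fintype_card, hF, hN.card_stabField]
      have := hN.one_lt_card_Gamma
      have h2 : ({0, 1} : Finset F).card ≤ 2 := Finset.card_le_two
      omega
    obtain ⟨x, -, hx⟩ := Finset.exists_mem_notMem_of_card_lt_card hcard
    simp only [Finset.mem_insert, Finset.mem_singleton, not_or] at hx
    exact ⟨x, x.2, fun h => hx.1 (Subtype.ext h), fun h => hx.2 (Subtype.ext h)⟩
  -- the multiplier `η` and the fibre element `n = τ_μ δ_η` with `(s n)² = 1`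
  have hd := hN.card_Lambda_eq_of_two rfl
  have hl : Units.mk0 η hη0 ∈ Lambda H := hN.mk0_mem_Lambda hd hηF hη0
  obtain ⟨P, hP1, hPi⟩ := hN.exists_sylow
  have heq : Nat.card (P : Subgroup H) - 1 = (if (2 : ℕ) = 2 then 1 else 2) * Nat.card (Lambda H) := by
    rw [if_pos rfl, one_mul, hd, card_Gamma_eq_card_sylow 2 H P hPi]
  have hfib := eps_le_card_fibre_of_eq 2 H P hP1 hPi heq hs hl
  rw [if_pos rfl] at hfib
  obtain ⟨⟨n, hnl, hnp⟩⟩ := (Nat.card_pos_iff.mp (lt_of_lt_of_le zero_lt_one hfib)).1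
  set μ := shiftInfty ((n : H) : PGL(Fin 2, k)) with hμ
  have hμF : μ ∈ F := hN.shiftInfty_mem n
  -- the trace condition: `γ μ + α (η + 1) = 0`
  have hlin : g 0 0 * η + g 1 0 * μ + g 1 1 = 0 := by
    rw [coe_stabilizer_eq_transl_mul_homoth n, hnl, ← mul_assoc, ← hgs,
      mk_mul_transl_mul_homoth_pow_char_eq_one_iff 2, eval_cosetQuad_of_two 2 rfl, eval_cosetLin,
      Units.val_mk0] at hnp
    exact pow_eq_zero_iff two_ne_zero |>.mp hnp
  have hη1' : η + 1 ≠ 0 := by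
    intro h
    apply hη1
    have : η = -1 := by linear_combination h
    rw [this, CharTwo.neg_eq]
  have hαγ : g 0 0 / g 1 0 = μ / (η + 1) := by
    rw [h11] at hlin
    rw [div_eq_div_iff hγ hη1']
    have : g 0 0 * (η + 1) = -(g 1 0 * μ) := by linear_combination hlin
    rw [this, CharTwo.neg_eq, mul_comm]
  refine ⟨μ / (η + 1), F.div_mem hμF (F.add_mem hηF F.one_mem), ?_⟩
  rw [← hgs, mk_smul, OnePoint.smul_infty_eq_ite, if_neg hγ, hαγ]

/-- **The orbit of `∞` is contained in `ℙ¹(𝔽_q)`** (`p = 2`, `q > 2`, normal form): every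
element of `H` not fixing `∞` moves it into `𝔽_q` (each coset of `Stab_H(∞)` contains an
involution, by the equality case of Lemma 6.3). [cite: Faber2011, §6.1.2] -/
theorem exists_smul_infty_eq_coe_of_two [IsAlgClosed k] (hp : p = 2) (hq : Nat.card (Gamma H) ≠ 2)
    {h : PGL(Fin 2, k)} (hh : h ∈ H) (hhi : h • (∞ : OnePoint k) ≠ ∞) :
    ∃ c ∈ stabField (Gamma H), h • (∞ : OnePoint k) = (c : OnePoint k) := by
  classical
  subst hp
  have hd := hN.card_Lambda_eq_of_two rfl
  obtain ⟨P, hP1, hPi⟩ := hN.exists_sylow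
  have heq : Nat.card (P : Subgroup H) - 1 = (if (2 : ℕ) = 2 then 1 else 2) * Nat.card (Lambda H) := by
    rw [if_pos rfl, one_mul, hd, card_Gamma_eq_card_sylow 2 H P hPi]
  have h1 : (1 : kˣ) ∈ Lambda H := (Lambda H).one_mem
  have hfib := eps_le_card_fibre_of_eq 2 H P hP1 hPi heq (s := ⟨h, hh⟩) hhi h1
  rw [if_pos rfl] at hfib
  obtain ⟨⟨n, -, hnp⟩⟩ := (Nat.card_pos_iff.mp (lt_of_lt_of_le zero_lt_one hfib)).1
  have hs : (((⟨h, hh⟩ : H) * (n : H) : H) : PGL(Fin 2, k)) • (∞ : OnePoint k) ≠ ∞ := by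
    rw [Subgroup.coe_mul, mul_smul, coe_stabilizer_smul_infty H n]
    exact hhi
  obtain ⟨c, hc, hsc⟩ := hN.exists_smul_infty_eq_coe_of_sq_eq_one rfl hq hs
    (by rw [Subgroup.coe_mul]; exact hnp)
  refine ⟨c, hc, ?_⟩
  rw [← hsc, Subgroup.coe_mul, mul_smul, coe_stabilizer_smul_infty H n]

/-- **Faber 2011, §6.1.2 at the level of orders: `|H| = q(q² - 1)`** for `k` algebraically closed
of characteristic `2` and `H ≤ PGL₂(k)` finite in normal form with `q = |Γ(H)| > 2` (there
`H = PSL₂(𝔽_q) = PGL₂(𝔽_q)`; here only the order, from `H·∞ ⊆ ℙ¹(𝔽_q)` and `|H| ≥ q(q-1)(q+1)`).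
[cite: Faber2011, Thm. 6.1, §6.1.2] -/
theorem card_eq_of_two [IsAlgClosed k] (hp : p = 2) (hq : Nat.card (Gamma H) ≠ 2) :
    Nat.card H = Nat.card (Gamma H) * (Nat.card (Gamma H) ^ 2 - 1) := by
  classical
  haveI := hN.finite_stabField
  haveI : Fintype (stabField (Gamma H)) := Fintype.ofFinite _
  set F := stabField (Gamma H) with hF
  set q := Nat.card (Gamma H) with hqdef
  have hd := hN.card_Lambda_eq_of_two hp
  -- upper bound from the orbit
  set S : Finset (OnePoint k) :=
    insert ∞ ((Finset.univ : Finset F).image fun c : F => (((c : F) : k) : OnePoint k)) with hSdef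
  have hS : ∀ h ∈ H, h • (∞ : OnePoint k) ∈ S := by
    intro h hh
    by_cases hhi : h • (∞ : OnePoint k) = ∞
    · rw [hhi, hSdef]; exact Finset.mem_insert_self _ _
    · obtain ⟨c, hc, hhc⟩ := hN.exists_smul_infty_eq_coe_of_two hp hq hh hhi
      rw [hhc, hSdef]
      exact Finset.mem_insert_of_mem (Finset.mem_image.mpr ⟨⟨c, hc⟩, Finset.mem_univ _, rfl⟩)
  have hScard : S.card ≤ q + 1 := by
    rw [hSdef]
    refine (Finset.card_insert_le _ _).trans ?_
    rw [add_le_add_iff_right]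
    refine Finset.card_image_le.trans ?_
    rw [Finset.card_univ, ← Nat.card_eq_fintype_card, hF, hN.card_stabField]
  have hle := hN.card_le_of_smul_infty_mem hS
  have hge := hN.mul_le_card
  rw [hd] at hle hge
  have hq1 := hN.one_lt_card_Gamma
  have hsq : q ^ 2 - 1 = (q - 1) * (q + 1) := by
    have : q ^ 2 - 1 = (q + 1) * (q - 1) := by simpa using Nat.sq_sub_sq q 1
    rw [this, mul_comm]
  rw [hsq, ← mul_assoc]
  apply le_antisymm
  · exact hle.trans (Nat.mul_le_mul_left _ hScard)
  · exact hge

/-! ### `q = 3`, `2d = q - 1`: the orbit of `∞` has four points, `|H| = 12` (Faber §6.1.1) -/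

/-- `q = 3` forces `p ≠ 2` (indeed `p = 3`): `q = |𝔽_Γ|` is a power of `p`. [folklore] -/
private theorem p_ne_two_of_card_Gamma_eq_three [IsAlgClosed k] (hq : Nat.card (Gamma H) = 3) :
    p ≠ 2 := by
  classical
  haveI := hN.finite_stabField
  haveI : Fintype (stabField (Gamma H)) := Fintype.ofFinite _
  haveI : CharP (stabField (Gamma H)) p := inferInstance
  obtain ⟨a, -, ha⟩ := FiniteField.card (stabField (Gamma H)) p
  rw [← Nat.card_eq_fintype_card, hN.card_stabField, hq] at ha
  intro h2
  rw [h2] at ha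
  have : 2 ∣ 2 ^ (a : ℕ) := dvd_pow_self 2 a.ne_zero
  rw [← ha] at this
  omega

/-- **Rational lower-left entries** (`q = 3`, `d = 1`, normal form; Faber 2011, §6.1.1, case
`q = 3`: "every element of `G` may be represented by a matrix with determinant `1` and lower left
entry in `𝔽_3`"): every `h ∈ H` has a lift `g` with `det g = 1` and `g₁₀ ∈ 𝔽_3`.  (For a
`3`-element `s = [g]` off the stabiliser, the two `3`-elements of the coset `s·Stab_H(∞)` have
shifts `0` and `-4/γ`, both in `𝔽_3`; the stabiliser consists of the translations `τ_μ`,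
`μ ∈ 𝔽_3`.) [cite: Faber2011, §6.1.1] -/
theorem exists_lift_det_eq_one_of_card_Gamma_eq_three [IsAlgClosed k] (hq : Nat.card (Gamma H) = 3)
    (hd : Nat.card (Lambda H) = 1) {h : PGL(Fin 2, k)} (hh : h ∈ H) :
    ∃ g : GL (Fin 2) k, Matrix.ProjGenLinGroup.mk g = h ∧ (g : Matrix (Fin 2) (Fin 2) k).det = 1 ∧
      g 1 0 ∈ stabField (Gamma H) := by
  classical
  have pp : p.Prime := Fact.out
  set F := stabField (Gamma H) with hF
  have hp2 : p ≠ 2 := hN.p_ne_two_of_card_Gamma_eq_three hq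
  have h2d : 2 * Nat.card (Lambda H) = Nat.card (Gamma H) - 1 := by rw [hd, hq]
  -- the stabiliser consists of translations
  have hΛ : Lambda H = ⊥ := by
    haveI : Finite (Lambda H) := Finite.of_surjective _ (stabDeriv H).rangeRestrict_surjective
    exact Subgroup.eq_bot_of_card_eq _ hd
  have hderiv : ∀ n : stabilizer H (∞ : OnePoint k), stabDeriv H n = 1 := fun n => by
    have : stabDeriv H n ∈ Lambda H := ⟨n, rfl⟩
    rwa [hΛ, Subgroup.mem_bot] at this
  have htransl : ∀ n : stabilizer H (∞ : OnePoint k),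
      ((n : H) : PGL(Fin 2, k)) = transl (shiftInfty ((n : H) : PGL(Fin 2, k))) := fun n => by
    have := coe_stabilizer_eq_transl_mul_homoth n
    rw [hderiv, map_one, mul_one] at this
    exact this
  have hdetU : ∀ μ : k, ((Matrix.GeneralLinearGroup.upperRightHom μ : GL (Fin 2) k) : Matrix (Fin 2) (Fin 2) k).det = 1 :=
    fun μ => by simp [Matrix.GeneralLinearGroup.upperRightHom_apply, Matrix.det_fin_two_of]
  by_cases hhi : h • (∞ : OnePoint k) = ∞
  · -- `h = τ_ν`
    let n : stabilizer H (∞ : OnePoint k) :=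
      ⟨⟨h, hh⟩, by rw [mem_stabilizer_iff, Subgroup.smul_def]; exact hhi⟩
    have hn : h = transl (shiftInfty h) := htransl n
    refine ⟨Matrix.GeneralLinearGroup.upperRightHom (shiftInfty h), ?_, hdetU _, ?_⟩
    · rw [← transl_apply, ← hn]
    · simp [Matrix.GeneralLinearGroup.upperRightHom_apply, F.zero_mem]
  · -- a `3`-element `s = h n₁` in the coset, with unipotent lift `g`
    obtain ⟨n₁, -, -, ⟨-, hp₁⟩, -⟩ :=
      hN.exists_ne_and_fibre hp2 h2d (s := ⟨h, hh⟩) hhi (Lambda H).one_mem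
    set s : H := ⟨h, hh⟩ * (n₁ : H) with hsdef
    have hsp : (s : PGL(Fin 2, k)) ^ p = 1 := by rw [hsdef, Subgroup.coe_mul]; exact hp₁
    have hsi : (s : PGL(Fin 2, k)) • (∞ : OnePoint k) ≠ ∞ := by
      rw [hsdef, Subgroup.coe_mul, mul_smul, coe_stabilizer_smul_infty H n₁]; exact hhi
    obtain ⟨g, hgs, hgp⟩ := KleinGeometry.exists_lift_pow_eq_one (s : PGL(Fin 2, k)) pp.pos hsp
    obtain ⟨htr, hdet⟩ := trace_eq_two_and_det_eq_one_of_pow_char_eq_one p hgp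
    have hγ : g 1 0 ≠ 0 := by
      intro h0; apply hsi; rw [← hgs, mk_smul_infty_eq_self_iff]; exact h0
    -- the two `3`-elements of the coset of `s`: shifts `0` and `-4/γ`, both in `𝔽_3`
    set l₁ : kˣ := Units.mk0 (1 : k) one_ne_zero * Units.mk0 (1 : k) one_ne_zero with hl₁def
    have hl₁ : l₁ ∈ Lambda H := by
      have : l₁ = 1 := Units.ext (by simp [hl₁def])
      rw [this]; exact (Lambda H).one_mem
    obtain ⟨m₁, m₂, hmne, ⟨hmd₁, hmp₁⟩, ⟨hmd₂, hmp₂⟩⟩ := hN.exists_ne_and_fibre hp2 h2d hsi hl₁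
    set μ₁ := shiftInfty ((m₁ : H) : PGL(Fin 2, k)) with hμ₁
    set μ₂ := shiftInfty ((m₂ : H) : PGL(Fin 2, k)) with hμ₂
    have hμ₁F : μ₁ ∈ F := hN.shiftInfty_mem m₁
    have hμ₂F : μ₂ ∈ F := hN.shiftInfty_mem m₂
    have hμne : μ₁ ≠ μ₂ := by
      intro h12
      apply hmne
      apply Subtype.ext; apply Subtype.ext
      refine eq_of_derivInfty_eq_of_shiftInfty_eq (coe_stabilizer_smul_infty H m₁)
        (coe_stabilizer_smul_infty H m₂) ?_ h12
      have := congrArg (fun u : kˣ => (u : k)) (hmd₁.trans hmd₂.symm)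
      simpa using this
    have hroot : ∀ m : stabilizer H (∞ : OnePoint k), (stabDeriv H m : kˣ) = l₁ →
        ((s : PGL(Fin 2, k)) * ((m : H) : PGL(Fin 2, k))) ^ p = 1 →
        (shiftInfty ((m : H) : PGL(Fin 2, k)) = (2 * 1 - (g 0 0 * 1 ^ 2 + g 1 1)) / g 1 0 ∨
          shiftInfty ((m : H) : PGL(Fin 2, k)) = (-(2 * 1) - (g 0 0 * 1 ^ 2 + g 1 1)) / g 1 0) := by
      intro m hmd hmp
      rw [coe_stabilizer_eq_transl_mul_homoth m, hmd, ← mul_assoc, ← hgs,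
        mk_mul_transl_mul_homoth_pow_char_eq_one_iff p] at hmp
      exact (eval_cosetQuad_eq_zero_iff hdet hγ one_ne_zero _).mp hmp
    obtain ⟨-, hmem⟩ := mem_and_mem_of_pair hμne (hroot m₁ hmd₁ hmp₁) (hroot m₂ hmd₂ hmp₂)
      (S := (F : Set k)) hμ₁F hμ₂F
    have htr' : g 0 0 + g 1 1 = 2 := by rw [← Matrix.trace_fin_two]; exact htr
    have h4 : (4 : k) ≠ 0 := by
      have h2 : (2 : k) ≠ 0 := by
        intro h
        have := (CharP.cast_eq_zero_iff k p 2).mp (by exact_mod_cast h)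
        exact hp2 ((Nat.prime_dvd_prime_iff_eq pp Nat.prime_two).mp this)
      rw [show (4 : k) = 2 * 2 by norm_num]; exact mul_ne_zero h2 h2
    have hγF : g 1 0 ∈ F := by
      have hval : (-(2 * 1) - (g 0 0 * 1 ^ 2 + g 1 1)) / g 1 0 = -4 / g 1 0 := by
        simp only [one_pow, mul_one]
        rw [htr']; norm_num
      rw [SetLike.mem_coe, hval] at hmem
      have hne : -4 / g 1 0 ≠ 0 := div_ne_zero (neg_ne_zero.mpr h4) hγ
      have : g 1 0 = -4 * (-4 / g 1 0)⁻¹ := by field_simp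
      rw [this]
      exact F.mul_mem (F.neg_mem (by exact_mod_cast natCast_mem F 4)) (F.inv_mem hmem)
    -- `h = s n₁⁻¹ = [g] τ_{-ν}`
    set ν := shiftInfty ((n₁ : H) : PGL(Fin 2, k)) with hν
    have hn₁ : ((n₁ : H) : PGL(Fin 2, k)) = transl ν := htransl n₁
    have hh' : h = Matrix.ProjGenLinGroup.mk (g * Matrix.GeneralLinearGroup.upperRightHom (-ν)) := by
      rw [map_mul, hgs, ← transl_apply, AddChar.map_neg_eq_inv, ← hn₁, hsdef, Subgroup.coe_mul,
        mul_inv_cancel_right]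
    refine ⟨g * Matrix.GeneralLinearGroup.upperRightHom (-ν), hh'.symm, ?_, ?_⟩
    · rw [Units.val_mul, Matrix.det_mul, hdet, hdetU, mul_one]
    · rw [Units.val_mul, Matrix.mul_apply, Fin.sum_univ_two]
      simp [Matrix.GeneralLinearGroup.upperRightHom_apply, hγF]

/-- **Faber 2011, §6.1.1 (`q = 3`) at the level of orders: `|H| ≤ 12`** for `k` algebraically
closed and `H ≤ PGL₂(k)` finite in normal form with `q = |Γ(H)| = 3` and `d = |Λ(H)| = 1` (there
`H = PSL₂(𝔽_3) ≅ 𝔄₄`; here: the orbit of `∞` lies in `{∞} ∪ (x₀ + 𝔽_3)` — for `h, h' ∈ H` off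
the stabiliser with rational-lower-left lifts `g, g'` of determinant `1`, the lower-left entry
`γ α' + δ γ'` of `g g'` is again rational up to sign, so `h'.∞ - h⁻¹.∞ = α'/γ' + δ/γ ∈ 𝔽_3`).
[cite: Faber2011, Thm. 6.1, §6.1.1] -/
theorem card_le_twelve_of_card_Gamma_eq_three [IsAlgClosed k] (hq : Nat.card (Gamma H) = 3)
    (hd : Nat.card (Lambda H) = 1) : Nat.card H ≤ 12 := by
  classical
  have pp : p.Prime := Fact.out
  haveI := hN.finite_stabField
  haveI : Fintype (stabField (Gamma H)) := Fintype.ofFinite _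
  set F := stabField (Gamma H) with hF
  -- an element `h₀` off the stabiliser and its lift `g₀`
  obtain ⟨h₀, hh₀, hh₀i⟩ : ∃ h₀ ∈ H, h₀ • (∞ : OnePoint k) ≠ ∞ := by
    by_contra hcon
    push Not at hcon
    apply hN.stabilizer_ne_top
    rw [eq_top_iff]
    intro x _
    rw [mem_stabilizer_iff, Subgroup.smul_def]
    exact hcon x x.2
  obtain ⟨g₀, hg₀, hdet₀, hc₀⟩ := hN.exists_lift_det_eq_one_of_card_Gamma_eq_three hq hd hh₀
  have hc₀0 : g₀ 1 0 ≠ 0 := by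
    intro h0; apply hh₀i; rw [← hg₀, mk_smul_infty_eq_self_iff]; exact h0
  set x₀ : k := -(g₀ 1 1 / g₀ 1 0) with hx₀
  set S : Finset (OnePoint k) :=
    insert ∞ ((Finset.univ : Finset F).image fun t : F => ((x₀ + (t : k) : k) : OnePoint k))
    with hSdef
  have hScard : S.card ≤ 4 := by
    rw [hSdef]
    refine (Finset.card_insert_le _ _).trans ?_
    have : ((Finset.univ : Finset F).image fun t : F => ((x₀ + (t : k) : k) : OnePoint k)).card ≤ 3 := by
      refine Finset.card_image_le.trans ?_
      rw [Finset.card_univ, ← Nat.card_eq_fintype_card, hF, hN.card_stabField, hq]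
    omega
  have hS : ∀ h ∈ H, h • (∞ : OnePoint k) ∈ S := by
    intro h hh
    by_cases hhi : h • (∞ : OnePoint k) = ∞
    · rw [hhi, hSdef]; exact Finset.mem_insert_self _ _
    obtain ⟨g, hg, hdet, hc⟩ := hN.exists_lift_det_eq_one_of_card_Gamma_eq_three hq hd hh
    have hc0 : g 1 0 ≠ 0 := by
      intro h0; apply hhi; rw [← hg, mk_smul_infty_eq_self_iff]; exact h0
    -- the product `h₀ h` and its rational lift
    obtain ⟨ĝ, hĝ, hdetĝ, hĉ⟩ :=
      hN.exists_lift_det_eq_one_of_card_Gamma_eq_three hq hd (H.mul_mem hh₀ hh)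
    have hmk : Matrix.ProjGenLinGroup.mk (g₀ * g) = Matrix.ProjGenLinGroup.mk ĝ := by
      rw [map_mul, hg₀, hg, hĝ]
    obtain ⟨u, hu⟩ := GL2.mk_eq_mk_iff_smul.mp hmk
    have hu2 : (u : k) ^ 2 = 1 := by
      have := congrArg Matrix.det hu
      rw [Matrix.det_smul, Fintype.card_fin, Units.val_mul, Matrix.det_mul, hdet₀, hdet, hdetĝ,
        mul_one, mul_one] at this
      exact this
    have huF : (u : k) ∈ F := by
      have : ((u : k) - 1) * ((u : k) + 1) = 0 := by linear_combination hu2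
      rcases mul_eq_zero.mp this with h1 | h1
      · rw [sub_eq_zero.mp h1]; exact F.one_mem
      · rw [eq_neg_of_add_eq_zero_left h1]; exact F.neg_mem F.one_mem
    have hentry : (u : k) * (g₀ 1 0 * g 0 0 + g₀ 1 1 * g 1 0) = ĝ 1 0 := by
      have := congrArg (fun M : Matrix (Fin 2) (Fin 2) k => M 1 0) hu
      simp only [Matrix.smul_apply, Units.val_mul, Matrix.mul_apply, Fin.sum_univ_two,
        smul_eq_mul] at this
      exact this
    have hprodF : g₀ 1 0 * g 0 0 + g₀ 1 1 * g 1 0 ∈ F := by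
      have hu0 : (u : k) ≠ 0 := u.ne_zero
      have : g₀ 1 0 * g 0 0 + g₀ 1 1 * g 1 0 = (u : k)⁻¹ * ĝ 1 0 := by
        rw [← hentry, inv_mul_cancel_left₀ hu0]
      rw [this]
      exact F.mul_mem (F.inv_mem huF) hĉ
    -- `h • ∞ = α/γ = x₀ + t` with `t ∈ 𝔽_3`
    set t : k := (g₀ 1 0 * g 0 0 + g₀ 1 1 * g 1 0) / (g₀ 1 0 * g 1 0) with ht
    have htF : t ∈ F := F.div_mem hprodF (F.mul_mem hc₀ hc)
    have hval : g 0 0 / g 1 0 = x₀ + t := by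
      rw [hx₀, ht]
      field_simp
      ring
    rw [← hg, mk_smul, OnePoint.smul_infty_eq_ite, if_neg hc0, hval, hSdef]
    exact Finset.mem_insert_of_mem (Finset.mem_image.mpr ⟨⟨t, htF⟩, Finset.mem_univ _, rfl⟩)
  have hle := hN.card_le_of_smul_infty_mem hS
  rw [hq, hd] at hle
  omega

/-! ### `p = 2`, `q = 2`: a subgroup of index `2` of odd order (Faber §6.1.3) -/

/-- **Faber 2011, §6.1.3 at the level of orders** (`p = 2`, `q = |Γ(H)| = 2`, normal form; there
`H ≅ 𝔇_{1+2f}` is dihedral of order `2(1 + 2f)`): `H` has a subgroup `K` of index `2` and odd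
order.  Here `|Stab_H(∞)| = 2` and the number `1 + 2f` of Sylow `2`-subgroups is odd, so
`|H| = 2 · odd`; the translation `τ_1 ∈ H` acts on `H` by left multiplication as an odd
permutation (a product of `|H|/2` transpositions), and `K` is the kernel of the sign of the regular
representation. [cite: Faber2011, Thm. 6.1, §6.1.3] -/
theorem exists_index_two_of_card_Gamma_eq_two [IsAlgClosed k] (hp : p = 2)
    (hq : Nat.card (Gamma H) = 2) :
    ∃ K : Subgroup PGL(Fin 2, k), K ≤ H ∧ Nat.card H = 2 * Nat.card K ∧ ¬ 2 ∣ Nat.card K := by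
  classical
  subst hp
  haveI : Fintype H := Fintype.ofFinite H
  -- `|Stab_H(∞)| = 2` and the index is odd
  have hd := hN.card_Lambda_eq_of_two rfl
  rw [hq] at hd
  obtain ⟨P, hP1, hPi⟩ := hN.exists_sylow
  have hP2 : Nat.card (P : Subgroup H) = 2 := by rw [← card_Gamma_eq_card_sylow 2 H P hPi, hq]
  have hStab : Nat.card (stabilizer H (∞ : OnePoint k)) = 2 := by
    have := card_stabilizer_eq_card_translSubgroup_mul H
    rw [← sylow_eq_translSubgroup 2 H P hPi, hP2] at this
    change _ = 2 * Nat.card (Lambda H) at this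
    rw [hd] at this
    simpa using this
  have hdvd := card_sylow_dvd_index_stabilizer_sub_one 2 H P hPi
  rw [hP2] at hdvd
  have hmul := Subgroup.card_mul_index (stabilizer H (∞ : OnePoint k))
  rw [hStab] at hmul
  have hidx1 : 1 ≤ (stabilizer H (∞ : OnePoint k)).index := Nat.one_le_iff_ne_zero.mpr
    Subgroup.index_ne_zero_of_finite
  have hodd : ¬ 2 ∣ (stabilizer H (∞ : OnePoint k)).index := by
    intro h2
    have := Nat.dvd_sub h2 hdvd
    rw [Nat.sub_sub_self hidx1] at this
    omega
  -- the involution `τ = τ_1 ∈ H`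
  have hτH : transl (1 : k) ∈ H := PGL2.mem_Gamma_iff.mp hN.one_mem
  set τ : H := ⟨transl (1 : k), hτH⟩ with hτdef
  have hτ1 : τ ≠ 1 := by
    intro h1
    have h1' : transl (1 : k) = 1 := congrArg Subtype.val h1
    have := shiftInfty_transl_mul_homoth (1 : k) 1
    rw [h1', one_mul, (homoth (k := k)).map_one,
      show (1 : PGL(Fin 2, k)) = Matrix.ProjGenLinGroup.mk 1 from (map_one _).symm,
      shiftInfty_mk] at this
    simp at this
  have hτ2 : τ ^ 2 = 1 := by
    apply Subtype.ext
    rw [SubmonoidClass.coe_pow, Subgroup.coe_one, hτdef, sq, ← AddChar.map_add_eq_mul,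
      CharTwo.add_self_eq_zero, AddChar.map_zero_eq_one]
  -- the sign of the regular representation
  set ρ : H →* Equiv.Perm H := MulAction.toPermHom H H with hρ
  set ψ : H →* ℤˣ := Equiv.Perm.sign.comp ρ with hψ
  have hρτ : ∀ x : H, ρ τ x = τ * x := fun x => rfl
  have hστ1 : ρ τ ≠ 1 := by
    intro h1
    apply hτ1
    have := congrArg (fun σ : Equiv.Perm H => σ 1) h1
    simpa [hρτ] using this
  have hστ2 : ρ τ ^ 2 = 1 := by rw [← map_pow, hτ2, map_one]
  have hord : orderOf (ρ τ) = 2 := orderOf_eq_prime hστ2 hστ1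
  obtain ⟨c, hc⟩ := Equiv.Perm.cycleType_prime_order (σ := ρ τ) (by rw [hord]; exact Nat.prime_two)
  rw [hord] at hc
  have hsupp : (ρ τ).support = Finset.univ := by
    ext x
    simp only [Equiv.Perm.mem_support, Finset.mem_univ, iff_true, hρτ]
    intro hx
    apply hτ1
    simpa using hx
  have hsum := Equiv.Perm.sum_cycleType (ρ τ)
  rw [hc, Multiset.sum_replicate, hsupp, Finset.card_univ, ← Nat.card_eq_fintype_card,
    smul_eq_mul] at hsum
  -- `c + 1 = index`, odd; so `sign (ρ τ) = -1`
  have hc1 : c + 1 = (stabilizer H (∞ : OnePoint k)).index := by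
    have : (c + 1) * 2 = 2 * (stabilizer H (∞ : OnePoint k)).index := by rw [hsum, hmul]
    omega
  have hsign : ψ τ = -1 := by
    rw [hψ, MonoidHom.comp_apply, Equiv.Perm.sign_of_cycleType, hc, Multiset.sum_replicate,
      Multiset.card_replicate, smul_eq_mul]
    apply Odd.neg_one_pow
    rw [show (c + 1) * 2 + (c + 1) = 3 * (c + 1) by ring, Nat.odd_mul]
    refine ⟨by decide, ?_⟩
    rw [hc1, Nat.odd_iff]
    omega
  -- `K = ker ψ` has index `2`
  have hrange : ψ.range = ⊤ := by
    rw [eq_top_iff]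
    intro u _
    rcases Int.units_eq_one_or u with rfl | rfl
    · exact ψ.range.one_mem
    · exact ⟨τ, hsign⟩
  have hidx : ψ.ker.index = 2 := by
    rw [Subgroup.index_ker, hrange, Subgroup.card_top, Nat.card_eq_fintype_card,
      Fintype.card_units_int]
  have hK := Subgroup.card_mul_index ψ.ker
  rw [hidx] at hK
  refine ⟨ψ.ker.map H.subtype, Subgroup.map_subtype_le _, ?_, ?_⟩
  · rw [Subgroup.card_map_of_injective H.subtype_injective]
    omega
  · rw [Subgroup.card_map_of_injective H.subtype_injective]
    intro h2
    apply hodd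
    have : Nat.card ψ.ker = (stabilizer H (∞ : OnePoint k)).index := by omega
    rwa [this] at h2

end IsNormalised

/-! ### Dickson's theorem for `p`-irregular subgroups, all characteristics, at the level of orders -/

omit [DecidableEq k] [Fact (Nat.Prime p)] [CharP k p] [Finite H] in
/-- Conjugating back: `K ≤ tHt⁻¹` gives `t⁻¹Kt ≤ H`. [folklore] -/
private theorem conj_inv_smul_le {K : Subgroup PGL(Fin 2, k)} {t : PGL(Fin 2, k)}
    (hK : K ≤ MulAut.conj t • H) : MulAut.conj t⁻¹ • K ≤ H := by
  intro x hx
  rw [mem_conj_smul_iff, inv_inv] at hx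
  have := hK hx
  rwa [mem_conj_smul_iff, ← mul_assoc, ← mul_assoc, inv_mul_cancel, one_mul, mul_assoc,
    inv_mul_cancel, mul_one] at this

/-- **Dickson's classification of the finite `p`-irregular subgroups of `PGL₂(k)`, all
characteristics, at the level needed for orders** (Faber 2011, Thm. B / Thm. 6.1 over `k = k̄`;
Dickson 1901, Ch. XII, §260).  Let `k` be algebraically closed of characteristic `p` and
`H ≤ PGL₂(k)` finite with `p ∣ |H|`.  Then one of: (i) `H` fixes a point of `ℙ¹(k)`; (ii) `H` is
conjugate to `PSL₂(𝔽_q)` or `PGL₂(𝔽_q)` for a finite subfield `𝔽_q ≤ k` (parts IV–V, `p` odd);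
(iii) `|H| = q(q² - 1)` for a finite subfield `𝔽_q`, `q > 3` (`p = 2`, where
`H ≃ PSL₂(𝔽_q) = PGL₂(𝔽_q)`, §6.1.2); (iv) `|H| ≤ 60` (`p = 3`: `𝔄₅` of §6.2.2, or `q = 3` and
`|H| ≤ 12`, i.e. `PSL₂(𝔽_3)`, §6.1.1); (v) `H` has a subgroup of index `2` of odd order (`p = 2`,
`q = 2`: `H` dihedral, §6.1.3). [cite: Faber2011, Thm. B, Thm. 6.1; Dickson1901, §260] -/
theorem exists_smul_eq_or_of_dvd_card [IsAlgClosed k] (H : Subgroup PGL(Fin 2, k)) [Finite H]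
    (hdvd : p ∣ Nat.card H) :
    (∃ x : OnePoint k, ∀ h ∈ H, h • x = x) ∨
    (∃ (E : Subfield k) (t : PGL(Fin 2, k)), Finite E ∧
      (MulAut.conj t • H = pslTwo E ∨ MulAut.conj t • H = pglTwo E)) ∨
    (∃ E : Subfield k, Finite E ∧ 3 < Nat.card E ∧ Nat.card H = Nat.card E * (Nat.card E ^ 2 - 1)) ∨
    Nat.card H ≤ 60 ∨
    (∃ K : Subgroup PGL(Fin 2, k), K ≤ H ∧ Nat.card H = 2 * Nat.card K ∧ ¬ 2 ∣ Nat.card K) := by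
  classical
  have pp : p.Prime := Fact.out
  by_cases hfix : ∃ x : OnePoint k, ∀ h ∈ H, h • x = x
  · exact Or.inl hfix
  right
  push Not at hfix
  obtain ⟨t, hN⟩ := exists_isNormalised_conj p H hdvd hfix
  have hcard : Nat.card (MulAut.conj t • H : Subgroup PGL(Fin 2, k)) = Nat.card H := card_conj_smul H t
  haveI := hN.finite_stabField
  haveI : Fintype (stabField (Gamma (MulAut.conj t • H))) := Fintype.ofFinite _
  haveI : CharP (stabField (Gamma (MulAut.conj t • H))) p := inferInstance
  have hq1 : 1 < Nat.card (Gamma (MulAut.conj t • H)) := hN.one_lt_card_Gamma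
  have hEq : Nat.card (stabField (Gamma (MulAut.conj t • H))) = Nat.card (Gamma (MulAut.conj t • H)) :=
    hN.card_stabField
  obtain ⟨a, -, ha⟩ := FiniteField.card (stabField (Gamma (MulAut.conj t • H))) p
  rw [← Nat.card_eq_fintype_card, hEq] at ha
  rcases hN.card_Lambda_eq_or with hd | ⟨hp2, h2d⟩
  · by_cases hp2 : p = 2
    · by_cases hq2 : Nat.card (Gamma (MulAut.conj t • H)) = 2
      · -- (v) `p = 2`, `q = 2`
        right; right; right
        obtain ⟨K, hK, hHK, hodd⟩ := hN.exists_index_two_of_card_Gamma_eq_two hp2 hq2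
        refine ⟨MulAut.conj t⁻¹ • K, conj_inv_smul_le hK, ?_, ?_⟩
        · rw [card_conj_smul, ← hcard, hHK]
        · rw [card_conj_smul]; exact hodd
      · -- (iii) `p = 2`, `q > 2`
        right; left
        refine ⟨stabField (Gamma (MulAut.conj t • H)), hN.finite_stabField, ?_, ?_⟩
        · rw [hEq, ha, hp2]
          rw [ha, hp2] at hq2 hq1
          have ha2 : 2 ≤ (a : ℕ) := by
            by_contra hlt
            have : (a : ℕ) = 1 := by have := a.pos; omega
            rw [this] at hq2
            exact hq2 rfl
          calc 3 < 2 ^ 2 := by norm_num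
            _ ≤ 2 ^ (a : ℕ) := Nat.pow_le_pow_right two_pos ha2
        · rw [← hcard, hEq]
          exact hN.card_eq_of_two hp2 hq2
    · -- `p` odd, `d = q - 1`: `PGL₂(𝔽_q)` or `𝔄₅`
      rcases hN.eq_pglTwo_or_card_eq_sixty hp2 hd with h | ⟨-, h60⟩
      · left
        exact ⟨stabField (Gamma (MulAut.conj t • H)), t, hN.finite_stabField, Or.inr h⟩
      · right; right; left
        rw [← hcard, h60]
  · by_cases hq3 : 3 < Nat.card (Gamma (MulAut.conj t • H))
    · -- `p` odd, `2d = q - 1`, `q > 3`: `PSL₂(𝔽_q)`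
      left
      exact ⟨stabField (Gamma (MulAut.conj t • H)), t, hN.finite_stabField,
        Or.inl (hN.eq_pslTwo hp2 h2d hq3)⟩
    · -- `q = 3`, `d = 1`: `|H| ≤ 12`
      right; right; left
      have hq3' : Nat.card (Gamma (MulAut.conj t • H)) = 3 := by
        have hq2 : Nat.card (Gamma (MulAut.conj t • H)) ≠ 2 := by
          intro h2
          rw [h2] at ha
          have h2a : 2 ∣ p ^ (a : ℕ) := ⟨1, by omega⟩
          have := (Nat.prime_dvd_prime_iff_eq Nat.prime_two pp).mp
            (Nat.prime_two.dvd_of_dvd_pow h2a)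
          exact hp2 this.symm
        omega
      have hd1 : Nat.card (Lambda (MulAut.conj t • H)) = 1 := by rw [hq3'] at h2d; omega
      have := hN.card_le_twelve_of_card_Gamma_eq_three hq3' hd1
      rw [← hcard]
      omega

end Literature.GroupTheory.SpecificGroups.PGL2
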